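import Summits.CriticalPhenomena.SAWScalingLimit.Theses.SAWTowerCount
import Literature.Probability.RandomPlanarGeometry.SAWScalingLimitFamily
import HarnessLib

/-!
# Route `SAWTowerCount`: the assembly `Assembly` (stmt-CriticalPhenomena-7261) — proved

Route `SAWTowerCount` of `CriticalPhenomena/SAWScalingLimit`, assembly item

  `Assembly := CorridorMassFiveEighths → ExponentIdentifies → ConfCovLimit → RestrictionOfLimit →
    TameOfLimit → SAWScalingLimit`.

This is pure logic over the route declarations plus the soft `integral_map` tail of the
Lawler–Schramm–Werner programme, which is PROVED in the tree
(`Literature.Probability.RandomPlanarGeometry.SAW.IsScalingLimitFamily.sawScalingLimit`: a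
scaling-limit family all of whose laws are chordal SLE_{8/3} laws gives `SAWScalingLimit`):

* `ConfCovLimit` supplies a chordal family `P` with the full scaling limit `(lim)` and conformal
  covariance `(conf)`; `(IsChordal, lim)` is literally `SAW.IsScalingLimitFamily P`;
* `RestrictionOfLimit` and `TameOfLimit`, fed with `P`, `IsChordal` and `(lim)`, give the
  two-sided restriction property and tameness of `P`;
* `ExponentIdentifies`, fed with the target `CorridorMassFiveEighths` and the four properties of
  `P`, identifies `P D` as the chordal SLE_{8/3} law for every Dobrushin domain `D`;
* `IsScalingLimitFamily.sawScalingLimit` turns "scaling-limit family of SLE_{8/3} laws" into the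
  conjunct `SAWScalingLimit` (write `P D = W.map Γ`, move the test integrals along `integral_map`;
  measurability of `γ ↦ γ.curve` is `SAW.aemeasurable_curve`).

The term is the route's deciding theorem `closes` with its last step factored through the
Literature lemma; no new definitions, no named-fact hypotheses.

## References

* G. F. Lawler, O. Schramm, W. Werner, *On the scaling limit of planar self-avoiding walk*, Proc.
  Sympos. Pure Math. 72 (2004), §3.4.2 and §4.1, Prediction 1 [LawlerSchrammWerner2004SAW].
* G. F. Lawler, O. Schramm, W. Werner, *Conformal restriction: the chordal case*, J. Amer. Math.
  Soc. 16 (2003) [LawlerSchrammWerner2003Restriction].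
-/

noncomputable section

open MeasureTheory Filter Topology Set
open scoped NNReal ENNReal
open Literature.Probability.RandomPlanarGeometry Literature.Probability.RandomPlanarGeometry.SAW
open Literature.Probability.LatticeModels

namespace Summit.CriticalPhenomena.SAWScalingLimit.Theorems

open Summit.CriticalPhenomena.SAWScalingLimit.Theses.SAWTowerCount

/-- **The assembly of route `SAWTowerCount`** (item stmt-CriticalPhenomena-7261): the corridor
target `CorridorMassFiveEighths`, the identification crux `ExponentIdentifies`, the shared limit
crux `ConfCovLimit` and the supports `RestrictionOfLimit`, `TameOfLimit` imply the conjunct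
`SAWScalingLimit` (the critical `δℤ²` SAW converges in law to chordal SLE_{8/3} in every Dobrushin
domain under every endpoint approximation). Proof: take `P` from `ConfCovLimit`; restriction and
tameness of `P` from the two supports; `ExponentIdentifies` makes every `P D` the chordal SLE_{8/3}
law; `SAW.IsScalingLimitFamily.sawScalingLimit` (LSW 2004 §4.1: the `integral_map` step) concludes.
[cite: LawlerSchrammWerner2004SAW, §3.4.2 and §4.1 Prediction 1] -/
theorem sawTowerCount_assembly_proof :
    Summit.CriticalPhenomena.SAWScalingLimit.Theses.SAWTowerCount.Assembly := by
  unfold Summit.CriticalPhenomena.SAWScalingLimit.Theses.SAWTowerCount.Assembly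
  intro hX hE hC hR hT
  obtain ⟨P, hP, hlim, hconf⟩ := hC
  have hfam : IsScalingLimitFamily P := ⟨hP, hlim⟩
  exact hfam.sawScalingLimit (hE hX P hP hlim hconf (hR P hP hlim) (hT P hP hlim))

end Summit.CriticalPhenomena.SAWScalingLimit.Theorems

end
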